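import Mathlib.Algebra.Homology.TotalComplex
import Mathlib.Algebra.Homology.Additive
import Mathlib.CategoryTheory.Limits.Preserves.Shapes.Products
import HarnessLib

/-!
# The total complex commutes with an additive functor preserving the relevant coproducts

For an additive functor `G : C ⥤ D` between preadditive categories and a bicomplex `K` (Mathlib
`HomologicalComplex₂ C c₁ c₂`) whose total complex exists, write `G••K` for `G` applied termwise
(`((G.mapHomologicalComplex c₂).mapHomologicalComplex c₁).obj K`). If `G` preserves the coproducts
`∐_{π(i) = j} K_i` defining the total complex (automatic for finite ones, or for an equivalence), then

  `mapTotalIso G K c₁₂ : (G••K).total c₁₂ ≅ G•(K.total c₁₂)`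

(`HomologicalComplex.Hom.isoOfComponents` on Mathlib's coproduct comparison `sigmaComparison`), compatibly
with the summand inclusions (`ιTotal_mapTotalIso_hom : ι ≫ iso = G(ι)`) and NATURAL in `K`
(`total.map (G••φ) ≫ iso = iso ≫ G•(total.map φ)`). Mathlib has `total.map`/`total.mapIso` for morphisms of
bicomplexes but no comparison for a functor applied to the ambient category; this file supplies it.
Motivation (cell `pub-hodge-ring2`, banked support target `HomComplex.IsISemiregularC.of_schemeIso`, piece (N1)):
the internal Hom complex `𝓗om•(K, L)` of the venture HSemireg is a total complex, and its transport along the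
equivalence `e_*` of module categories of an isomorphism of schemes is `mapTotalIso` for `G = e_*` composed with the
module-level `e_* 𝓗om(A, B) ≅ 𝓗om(e_*A, e_*B)`.

References: C. A. Weibel, *An introduction to homological algebra* (1994), §1.2 (total complexes, 1.2.6) and §2.6
(additive functors) [Weibel1994]; folklore bookkeeping.
-/

noncomputable section

-- `GradedObject`/`HomologicalComplex₂.toGradedObject` are not reducible (as in Mathlib's `Algebra/Homology/TotalComplex.lean`).
set_option backward.isDefEq.respectTransparency false

open CategoryTheory CategoryTheory.Category CategoryTheory.Limits

universe v₁ v₂ u₁ u₂ w₁ w₂ w₃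

namespace Literature.Algebra.Homology

variable {C : Type u₁} [Category.{v₁} C] [Preadditive C] {D : Type u₂} [Category.{v₂} D] [Preadditive D]
  (G : C ⥤ D) [G.Additive]
  {I₁ : Type w₁} {I₂ : Type w₂} {I₁₂ : Type w₃} {c₁ : ComplexShape I₁} {c₂ : ComplexShape I₂}
  (K : HomologicalComplex₂ C c₁ c₂) (c₁₂ : ComplexShape I₁₂) [TotalComplexShape c₁ c₂ c₁₂] [DecidableEq I₁₂]

/-- `G` applied termwise to a bicomplex (`G••K`). [cite: Weibel1994, §2.6 (additive functors on complexes)] -/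
abbrev mapBicomplex : HomologicalComplex₂ D c₁ c₂ :=
  ((G.mapHomologicalComplex c₂).mapHomologicalComplex c₁).obj K

/-- The terms of `G••K`: `(G••K)_{i} = G(K_i)`. [cite: Weibel1994, §1.2 (double complexes)] -/
theorem mapBicomplex_toGradedObject (i : I₁ × I₂) :
    (mapBicomplex G K).toGradedObject i = G.obj (K.toGradedObject i) := rfl

variable [K.HasTotal c₁₂] [(mapBicomplex G K).HasTotal c₁₂]
  [∀ j : I₁₂, PreservesColimit
    (Discrete.functor (K.toGradedObject.mapObjFun (ComplexShape.π c₁ c₂ c₁₂) j)) G]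

omit [DecidableEq I₁₂] [K.HasTotal c₁₂]
  [∀ j : I₁₂, PreservesColimit (Discrete.functor (K.toGradedObject.mapObjFun (ComplexShape.π c₁ c₂ c₁₂) j)) G] in
/-- The coproduct `∐_{π(i)=j} G(K_i)` exists (it is the degree-`j` term of `(G••K).total`). [cite: Weibel1994, §1.2, 1.2.6] -/
theorem hasCoproduct_map (j : I₁₂) :
    HasCoproduct (fun b => G.obj (K.toGradedObject.mapObjFun (ComplexShape.π c₁ c₂ c₁₂) j b)) := by
  change HasCoproduct ((mapBicomplex G K).toGradedObject.mapObjFun (ComplexShape.π c₁ c₂ c₁₂) j)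
  infer_instance

/-- **The degree-`j` comparison isomorphism** `((G••K).total)_j = ∐ G(K_i) ≅ G(∐ K_i) = G((K.total)_j)` (the inverse of
Mathlib's `PreservesCoproduct.iso`; its `hom` is `sigmaComparison`). [cite: Weibel1994, §1.2, 1.2.6] -/
def totalComparisonIso (j : I₁₂) :
    ((mapBicomplex G K).total c₁₂).X j ≅ G.obj ((K.total c₁₂).X j) :=
  haveI := hasCoproduct_map G K c₁₂ j
  (PreservesCoproduct.iso G (K.toGradedObject.mapObjFun (ComplexShape.π c₁ c₂ c₁₂) j)).symm

/-- The degree-`j` comparison morphism `∐ G(K_i) ⟶ G(∐ K_i)` (= `sigmaComparison`). [cite: Weibel1994, §1.2, 1.2.6] -/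
def totalComparison (j : I₁₂) :
    ((mapBicomplex G K).total c₁₂).X j ⟶ G.obj ((K.total c₁₂).X j) :=
  (totalComparisonIso G K c₁₂ j).hom

/-- `totalComparison` is Mathlib's `sigmaComparison`. [cite: Weibel1994, §1.2, 1.2.6] -/
theorem totalComparison_eq (j : I₁₂) :
    totalComparison G K c₁₂ j =
      @sigmaComparison _ _ _ _ _ G (K.toGradedObject.mapObjFun (ComplexShape.π c₁ c₂ c₁₂) j) _
        (hasCoproduct_map G K c₁₂ j) := rfl

/-- `ι ≫ comparison = G(ι)` on the summand inclusions. [cite: Weibel1994, §1.2, 1.2.6] -/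
@[reassoc]
theorem ιTotal_totalComparison (i₁ : I₁) (i₂ : I₂) (j : I₁₂) (h : ComplexShape.π c₁ c₂ c₁₂ (i₁, i₂) = j) :
    (mapBicomplex G K).ιTotal c₁₂ i₁ i₂ j h ≫ totalComparison G K c₁₂ j = G.map (K.ιTotal c₁₂ i₁ i₂ j h) := by
  haveI := hasCoproduct_map G K c₁₂ j
  rw [totalComparison_eq]
  exact ι_comp_sigmaComparison G (K.toGradedObject.mapObjFun (ComplexShape.π c₁ c₂ c₁₂) j) ⟨(i₁, i₂), h⟩

/-- `ιOrZero ≫ comparison = G(ιOrZero)`. [cite: Weibel1994, §1.2, 1.2.6] -/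
theorem ιTotalOrZero_totalComparison (i₁ : I₁) (i₂ : I₂) (j : I₁₂) :
    (mapBicomplex G K).ιTotalOrZero c₁₂ i₁ i₂ j ≫ totalComparison G K c₁₂ j =
      G.map (K.ιTotalOrZero c₁₂ i₁ i₂ j) := by
  by_cases h : ComplexShape.π c₁ c₂ c₁₂ (i₁, i₂) = j
  · rw [HomologicalComplex₂.ιTotalOrZero_eq _ _ _ _ _ h, HomologicalComplex₂.ιTotalOrZero_eq _ _ _ _ _ h,
      ιTotal_totalComparison]
  · simp only [HomologicalComplex₂.ιTotalOrZero_eq_zero _ _ _ _ _ h, zero_comp, Functor.map_zero]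

/-- The horizontal summand differential: `d₁(G••K) ≫ comparison = G(d₁ K)`. [cite: Weibel1994, §1.2, 1.2.6 (sign trick)] -/
theorem d₁_totalComparison (i₁ : I₁) (i₂ : I₂) (j : I₁₂) :
    (mapBicomplex G K).d₁ c₁₂ i₁ i₂ j ≫ totalComparison G K c₁₂ j = G.map (K.d₁ c₁₂ i₁ i₂ j) := by
  by_cases h : c₁.Rel i₁ (c₁.next i₁)
  · rw [HomologicalComplex₂.d₁_eq' _ _ h, HomologicalComplex₂.d₁_eq' _ _ h, Units.smul_def, Units.smul_def,
      Preadditive.zsmul_comp, Category.assoc, ιTotalOrZero_totalComparison, G.map_zsmul, G.map_comp]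
    rfl
  · simp only [HomologicalComplex₂.d₁_eq_zero _ _ _ _ _ h, zero_comp, Functor.map_zero]

/-- The vertical summand differential: `d₂(G••K) ≫ comparison = G(d₂ K)`. [cite: Weibel1994, §1.2, 1.2.6 (sign trick)] -/
theorem d₂_totalComparison (i₁ : I₁) (i₂ : I₂) (j : I₁₂) :
    (mapBicomplex G K).d₂ c₁₂ i₁ i₂ j ≫ totalComparison G K c₁₂ j = G.map (K.d₂ c₁₂ i₁ i₂ j) := by
  by_cases h : c₂.Rel i₂ (c₂.next i₂)
  · rw [HomologicalComplex₂.d₂_eq' _ _ _ h, HomologicalComplex₂.d₂_eq' _ _ _ h, Units.smul_def, Units.smul_def,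
      Preadditive.zsmul_comp, Category.assoc, ιTotalOrZero_totalComparison, G.map_zsmul, G.map_comp]
    rfl
  · simp only [HomologicalComplex₂.d₂_eq_zero _ _ _ _ _ h, zero_comp, Functor.map_zero]

/-- The comparison commutes with the total differentials: `d(G••K) ≫ cmp = cmp ≫ G(d K)`. [cite: Weibel1994, §1.2, 1.2.6] -/
theorem total_d_totalComparison (j j' : I₁₂) :
    ((mapBicomplex G K).total c₁₂).d j j' ≫ totalComparison G K c₁₂ j' =
      totalComparison G K c₁₂ j ≫ G.map ((K.total c₁₂).d j j') := by
  apply HomologicalComplex₂.total.hom_ext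
  intro i₁ i₂ h
  rw [HomologicalComplex₂.total_d, HomologicalComplex₂.total_d, Preadditive.add_comp, Preadditive.comp_add,
    HomologicalComplex₂.ι_D₁_assoc, HomologicalComplex₂.ι_D₂_assoc, d₁_totalComparison, d₂_totalComparison,
    G.map_add, Preadditive.comp_add, Preadditive.comp_add, ιTotal_totalComparison_assoc, ιTotal_totalComparison_assoc,
    ← G.map_comp, ← G.map_comp, HomologicalComplex₂.ι_D₁, HomologicalComplex₂.ι_D₂]

/-- **The total complex commutes with `G`**: `(G••K).total ≅ G•(K.total)` for an additive functor `G` preserving the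
coproducts of the total complex. [cite: Weibel1994, §1.2, 1.2.6 and §2.6] -/
def mapTotalIso : (mapBicomplex G K).total c₁₂ ≅ (G.mapHomologicalComplex c₁₂).obj (K.total c₁₂) :=
  HomologicalComplex.Hom.isoOfComponents (fun j => totalComparisonIso G K c₁₂ j)
    (fun j j' _ => (total_d_totalComparison G K c₁₂ j j').symm)

/-- The components of `mapTotalIso` are the coproduct comparisons. [cite: Weibel1994, §1.2, 1.2.6] -/
theorem mapTotalIso_hom_f (j : I₁₂) : (mapTotalIso G K c₁₂).hom.f j = totalComparison G K c₁₂ j :=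
  HomologicalComplex.Hom.isoOfComponents_hom_f _ _ j

/-- `ι ≫ (mapTotalIso).hom_j = G(ι)`. [cite: Weibel1994, §1.2, 1.2.6] -/
theorem ιTotal_mapTotalIso_hom (i₁ : I₁) (i₂ : I₂) (j : I₁₂) (h : ComplexShape.π c₁ c₂ c₁₂ (i₁, i₂) = j) :
    (mapBicomplex G K).ιTotal c₁₂ i₁ i₂ j h ≫ (mapTotalIso G K c₁₂).hom.f j = G.map (K.ιTotal c₁₂ i₁ i₂ j h) := by
  rw [mapTotalIso_hom_f, ιTotal_totalComparison]

/-- **Naturality in the bicomplex**: for `φ : K ⟶ L`, `total.map (G••φ) ≫ iso_L = iso_K ≫ G•(total.map φ)`.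
[cite: Weibel1994, §1.2, 1.2.6] -/
theorem total_map_mapTotalIso_hom {L : HomologicalComplex₂ C c₁ c₂} (φ : K ⟶ L) [L.HasTotal c₁₂]
    [(mapBicomplex G L).HasTotal c₁₂]
    [∀ j : I₁₂, PreservesColimit (Discrete.functor (L.toGradedObject.mapObjFun (ComplexShape.π c₁ c₂ c₁₂) j)) G] :
    HomologicalComplex₂.total.map (((G.mapHomologicalComplex c₂).mapHomologicalComplex c₁).map φ) c₁₂ ≫
        (mapTotalIso G L c₁₂).hom =
      (mapTotalIso G K c₁₂).hom ≫ (G.mapHomologicalComplex c₁₂).map (HomologicalComplex₂.total.map φ c₁₂) := by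
  apply HomologicalComplex.hom_ext
  intro j
  apply HomologicalComplex₂.total.hom_ext
  intro i₁ i₂ h
  rw [HomologicalComplex.comp_f, HomologicalComplex.comp_f, mapTotalIso_hom_f, mapTotalIso_hom_f,
    HomologicalComplex₂.ιTotal_map_assoc, ιTotal_totalComparison, ← Category.assoc, ιTotal_totalComparison]
  erw [Functor.mapHomologicalComplex_map_f, Functor.mapHomologicalComplex_map_f]
  rw [← G.map_comp, ← G.map_comp, HomologicalComplex₂.ιTotal_map]

end Literature.Algebra.Homology

end
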